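import Summits.QuantumAdvantage.QuantumAdvantage.Theses.CompactnessLift

/-!
# Route CompactnessLift · assembly (item stmt-QuantumAdvantage-15276): `CompactnessPrinciple → LanguageLadder → QuantumAdvantage`

The route's assembly item is literally its deciding theorem `closes` (pure logic: if the summit
failed then `BQP ⊆ BPP`, the compactness principle gives one exponent `c` for the quadratic-uniform
Clifford+T class, and the ladder at that `c` exhibits a language outside `bp (DTIME (· ^ c))`).
Candidate attached to the item by grounder-ground-pool-g71-3 (`Cand15276.lean`); landed against the route
decl by the CompactnessLift line lead.
-/

namespace Summit.QuantumAdvantage.QuantumAdvantage.Theorems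

set_option linter.dupNamespace false

/-- **Assembly of route CompactnessLift** — closes item stmt-QuantumAdvantage-15276
(`CompactnessLift.Assembly := CompactnessPrinciple → LanguageLadder → QuantumAdvantage`): it is the
route's deciding theorem `CompactnessLift.closes` (modus tollens on `BQP ⊆ BPP`). -/
theorem compactnessLift_assembly_proof :
    Summit.QuantumAdvantage.QuantumAdvantage.Theses.CompactnessLift.Assembly := by
  unfold Summit.QuantumAdvantage.QuantumAdvantage.Theses.CompactnessLift.Assembly
  exact Summit.QuantumAdvantage.QuantumAdvantage.Theses.CompactnessLift.closes

end Summit.QuantumAdvantage.QuantumAdvantage.Theorems
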